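import Summits.AtomisticToContinuum.BoseEinsteinCondensation.Theorems.BECRewardDescentWalkGlueConvex
import HarnessLib

/-!
# Route `BECRewardDescent`, support item `WalkGlue` (stmt-AtomisticToContinuum-12880) — the
# convex-analysis skeleton of the reward walk, II: the bootstrap and the chord inequality

Helper file (does not close the item); sequel of `BECRewardDescentWalkGlueConvex.lean`. The informal
proof of `WalkGlue` walks the reward `s` from the reward-scale rung at `s₀ = θρa` down to `0⁺`:
`S = {s ∈ (0,s₀] : n₊(Ψ_u) ≤ ηN/2 on [s,s₀]}` is closed and open, using `-R'' ≤ 2Var/Δ` where the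
ground state is condensed and `∫₀^{s₀} 2CN/(c√(ρa u)) du ≤ min(τ, η/8)N`. Here is that argument as a
theorem about a concave real function, in the exact shape the finite-volume spectral inputs produce:

* `chord_le_chord_add_of_bootstrap` — **the abstract reward walk**: `R` concave on `[0, ∞)`,
  right-continuous at `0`, differentiable on `(0, s₀)` (uniqueness of the rewarded ground state);
  the pointwise response bound `R(u+h) + R(u-h) - 2R(u) ≥ -(2K(u)+ε)h²` (frequently as `h → 0⁺`)
  at every `u ∈ (0, s₀)` below the condensation threshold, `R'(u) < β` (`R'(u) = n₊` of the ground
  state by Hellmann–Feynman); a comparison function `G' = g`, `g' = 2K`; the initial rung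
  `chord(s₀) ≤ β₀`; and the budget `g(s₀) - g(u) ≤ β₁`, `β₀ + β₁ < β`, `g(s₀) - g(u) ≤ T`. Conclusion:
  `chord(s) ≤ chord(s₀) + T` on `(0, s₀]`. The proof is a real induction on the down-set of
  uncontrolled rewards `{u : R'(u) ≥ β}`: its supremum can be neither uncontrolled (its derivative is a
  right limit of controlled slopes `≤ β₀ + β₁`) nor controlled (its derivative is a left limit of
  uncontrolled slopes `≥ β`).

* `hasDerivAt_sqrt_budget`, `hasDerivAt_sqrt_potential`, `chord_le_chord_add_of_sqrt_budget` — the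
  route's instance `K(u) = A/√u` (`A = CN/(c√(ρa))`): `g(u) = 4A√u`, `G(u) = (8A/3)u√u`, budget
  `∫₀^{s₀} 2K = 4A√s₀`; with `s₀ = θρa` this is the walk cost `(4C√θ/c)N` of the route text, and
  the corollary reads: `chord(s₀) ≤ β₀`, `β₀ + 4A√s₀ < β`, `4A√s₀ ≤ T` ⇒ `chord(s) ≤ chord(s₀) + T`.

For the route: `β = ηN` (condensation threshold of SectorGap/CondensateVariance), `β₀ = ηN/4`
(from `RewardScaleChord(η/4, θ)`), `T = τN`; the `ℝ≥0∞ ↔ ℝ` bookkeeping of the reward curve is in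
`BECRewardDescentWalkGlueCurve.lean`.

References: [Griffiths1966], [Kato1966]; route text of BECRewardDescent, item WalkGlue.
-/

noncomputable section

open Set Filter Topology

namespace Summit.AtomisticToContinuum.BoseEinsteinCondensation.Theorems.WalkGlue

/-! ### The abstract reward walk (bootstrap) -/

/-- **The abstract reward walk.** Let `R` be concave on `[0, ∞)`, right-continuous at `0` and
differentiable on `(0, s₀)` (uniqueness of the rewarded ground state). Suppose:
* (local response bound under the condensation threshold `β`) at every `u ∈ (0, s₀)` with
  `R'(u) < β`, for every `ε > 0`, frequently as `h → 0⁺`,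
  `R(u+h) + R(u-h) - 2R(u) ≥ -(2K(u) + ε) h²`;
* (comparison function) `G' = g` on `(0, s₀]` and `g' = 2K` on `(0, s₀)`;
* (initial rung) `chord(s₀) = (R(s₀) - R(0))/s₀ ≤ β₀`;
* (budget) `0 ≤ g(s₀) - g(u) ≤ β₁` and `g(s₀) - g(u) ≤ T` for `u ∈ (0, s₀)`, with `β₀ + β₁ < β`.
Then `chord(s) ≤ chord(s₀) + T` for every `s ∈ (0, s₀]`. Proof: real induction — the set of
`u ∈ (0, s₀)` with `R'(u) ≥ β` is a down-set (concavity) whose supremum `s*` can neither carry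
`R'(s*) ≥ β` (right limit of slopes from the controlled side) nor `R'(s*) < β` (left limit of slopes
from the uncontrolled side), so it is empty; then `R'(u) ≤ R'₋(s₀) + g(s₀) - g(u) ≤ chord(s₀) + T`
everywhere and `chord(s) = lim_{u→0⁺} slope(u, s) ≤ sup R'`. [folklore] -/
theorem chord_le_chord_add_of_bootstrap {R G g K : ℝ → ℝ} {s₀ β β₀ β₁ T : ℝ}
    (hR : ConcaveOn ℝ (Ici 0) R) (hR0 : ContinuousWithinAt R (Ici 0) 0) (hs₀ : 0 < s₀)
    (hdiff : ∀ u ∈ Ioo 0 s₀, DifferentiableAt ℝ R u)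
    (hG : ∀ u ∈ Ioc 0 s₀, HasDerivAt G (g u) u)
    (hg : ∀ u ∈ Ioo 0 s₀, HasDerivAt g (2 * K u) u)
    (hloc : ∀ u ∈ Ioo 0 s₀, deriv R u < β → ∀ ε : ℝ, 0 < ε →
      ∃ᶠ h in 𝓝[>] (0 : ℝ), -((2 * K u + ε) * h ^ 2) ≤ R (u + h) + R (u - h) - 2 * R u)
    (hinit : slope R 0 s₀ ≤ β₀)
    (hβ₁ : ∀ u ∈ Ioo 0 s₀, g s₀ - g u ≤ β₁) (hβ₁0 : 0 ≤ β₁) (hβ : β₀ + β₁ < β)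
    (hT : ∀ u ∈ Ioo 0 s₀, g s₀ - g u ≤ T) :
    ∀ s ∈ Ioc 0 s₀, slope R 0 s ≤ slope R 0 s₀ + T := by
  have hRcont := continuousOn_Ioi_of_concaveOn hR
  have hIoo : Ioo 0 s₀ ⊆ Ici (0 : ℝ) := fun u hu => le_of_lt hu.1
  -- the left derivative at `s₀` is below the chord from `0`
  have hL : derivWithin R (Iio s₀) s₀ ≤ slope R 0 s₀ :=
    hR.leftDeriv_le_slope (le_refl (0 : ℝ)) hs₀.le hs₀ (differentiableWithinAt_Iio_of_concaveOn hR hs₀)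
  -- Step 2: on a controlled tail `[s, s₀)` the derivative is bounded by the budget
  have step2 : ∀ s ∈ Ioo 0 s₀, (∀ u ∈ Ioo s s₀, deriv R u < β) →
      deriv R s + g s ≤ derivWithin R (Iio s₀) s₀ + g s₀ := by
    intro s hs hgood
    have h := rightDeriv_add_le_leftDeriv_add hR hs.1 hs.2
      (fun u hu => hG u ⟨hs.1.trans_le hu.1, hu.2⟩) (fun u hu => hg u ⟨hs.1.trans hu.1, hu.2⟩)
      (fun u hu => hloc u ⟨hs.1.trans hu.1, hu.2⟩ (hgood u hu))
    rwa [(hdiff s hs).derivWithin (uniqueDiffWithinAt_Ioi s)] at h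
  -- Step 3 (bootstrap): every `u ∈ (0, s₀)` is controlled
  have hanti : AntitoneOn (deriv R) (Ioo 0 s₀) :=
    (hR.subset hIoo (convex_Ioo 0 s₀)).antitoneOn_deriv hdiff
  have hallgood : ∀ u ∈ Ioo 0 s₀, deriv R u < β := by
    by_contra hbad
    push Not at hbad
    obtain ⟨u₀, hu₀, hu₀bad⟩ := hbad
    set Bad : Set ℝ := {u | u ∈ Ioo 0 s₀ ∧ β ≤ deriv R u} with hBad
    have hBne : Bad.Nonempty := ⟨u₀, hu₀, hu₀bad⟩
    have hBbdd : BddAbove Bad := ⟨s₀, fun u hu => hu.1.2.le⟩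
    have hdown : ∀ u ∈ Bad, ∀ w ∈ Ioo 0 s₀, w ≤ u → w ∈ Bad :=
      fun u hu w hw hwu => ⟨hw, hu.2.trans (hanti hw hu.1 hwu)⟩
    -- a controlled point `w₁` below `s₀`
    obtain ⟨w₁, hw₁, hw₁good⟩ : ∃ w₁ ∈ Ioo 0 s₀, deriv R w₁ < β := by
      have hD : HasDerivWithinAt R (derivWithin R (Iio s₀) s₀) (Iio s₀) s₀ :=
        (differentiableWithinAt_Iio_of_concaveOn hR hs₀).hasDerivWithinAt
      have ht : Tendsto (slope R s₀) (𝓝[<] s₀) (𝓝 (derivWithin R (Iio s₀) s₀)) :=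
        (hasDerivWithinAt_iff_tendsto_slope' self_notMem_Iio).1 hD
      have hlt : derivWithin R (Iio s₀) s₀ < β := by linarith
      have hev1 : ∀ᶠ w in 𝓝[<] s₀, slope R s₀ w < β := ht (Iio_mem_nhds hlt)
      obtain ⟨w₀, hw₀, hw₀mem⟩ := (hev1.and (Ioo_mem_nhdsLT hs₀)).exists
      rw [slope_comm] at hw₀
      have hRs₀ : ContinuousWithinAt R (Iio s₀) s₀ :=
        (hRcont.continuousAt (Ioi_mem_nhds hs₀)).continuousWithinAt
      have hcont : Tendsto (fun u => slope R w₀ u) (𝓝[<] s₀) (𝓝 (slope R w₀ s₀)) := by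
        simp only [slope_def_field]
        exact ((hRs₀.sub continuousWithinAt_const).div
          (continuousWithinAt_id.sub continuousWithinAt_const) (sub_ne_zero.2 hw₀mem.2.ne')).tendsto
      have hev2 : ∀ᶠ u in 𝓝[<] s₀, slope R w₀ u < β := hcont (Iio_mem_nhds hw₀)
      obtain ⟨w₁, hw₁slope, hw₁mem⟩ := (hev2.and (Ioo_mem_nhdsLT hw₀mem.2)).exists
      have hw₁' : w₁ ∈ Ioo 0 s₀ := ⟨hw₀mem.1.trans hw₁mem.1, hw₁mem.2⟩
      exact ⟨w₁, hw₁', (hR.deriv_le_slope hw₀mem.1.le hw₁'.1.le hw₁mem.1 (hdiff w₁ hw₁')).trans_lt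
        hw₁slope⟩
    set sStar := sSup Bad with hsStar
    have hs_le : ∀ u ∈ Bad, u ≤ sStar := fun u hu => le_csSup hBbdd hu
    have hpos : 0 < sStar := hu₀.1.trans_le (hs_le u₀ ⟨hu₀, hu₀bad⟩)
    have hle_w₁ : sStar ≤ w₁ := by
      refine csSup_le hBne fun u hu => ?_
      by_contra h
      push Not at h
      exact absurd hw₁good (not_lt.2 (hdown u hu w₁ hw₁ h.le).2)
    have hlt : sStar < s₀ := hle_w₁.trans_lt hw₁.2
    have hmemS : sStar ∈ Ioo 0 s₀ := ⟨hpos, hlt⟩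
    have hgood_above : ∀ u ∈ Ioo sStar s₀, deriv R u < β := by
      intro u hu
      by_contra h
      push Not at h
      exact absurd hu.1 (not_lt.2 (hs_le u ⟨⟨hpos.trans hu.1, hu.2⟩, h⟩))
    have hbound_above : ∀ u ∈ Ioo sStar s₀, deriv R u ≤ β₀ + β₁ := by
      intro u hu
      have hu' : u ∈ Ioo 0 s₀ := ⟨hpos.trans hu.1, hu.2⟩
      have h := step2 u hu' fun w hw => hgood_above w ⟨hu.1.trans hw.1, hw.2⟩
      linarith [hβ₁ u hu']
    by_cases hcase : β ≤ deriv R sStar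
    · -- `sStar` uncontrolled: its (right) derivative is a limit of controlled slopes
      have hslope_le : ∀ w ∈ Ioo sStar s₀, slope R sStar w ≤ β₀ + β₁ := by
        intro w hw
        have hRc : ContinuousWithinAt R (Ioi sStar) sStar :=
          (hRcont.continuousAt (Ioi_mem_nhds hpos)).continuousWithinAt
        have hcont : Tendsto (fun u => slope R u w) (𝓝[>] sStar) (𝓝 (slope R sStar w)) := by
          simp only [slope_def_field]
          exact ((continuousWithinAt_const.sub hRc).div
            (continuousWithinAt_const.sub continuousWithinAt_id) (sub_ne_zero.2 hw.1.ne')).tendsto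
        have hev : ∀ᶠ u in 𝓝[>] sStar, slope R u w ≤ β₀ + β₁ := by
          filter_upwards [Ioo_mem_nhdsGT hw.1] with u hu
          have hu' : u ∈ Ioo 0 s₀ := ⟨hpos.trans hu.1, hu.2.trans hw.2⟩
          exact (hR.slope_le_deriv hu'.1.le (hpos.trans hw.1).le hu.2 (hdiff u hu')).trans
            (hbound_above u ⟨hu.1, hu'.2⟩)
        exact le_of_tendsto hcont hev
      have hD : Tendsto (slope R sStar) (𝓝[>] sStar) (𝓝 (deriv R sStar)) :=
        (hasDerivWithinAt_iff_tendsto_slope' self_notMem_Ioi).1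
          (hdiff sStar hmemS).hasDerivAt.hasDerivWithinAt
      have hev : ∀ᶠ w in 𝓝[>] sStar, slope R sStar w ≤ β₀ + β₁ := by
        filter_upwards [Ioo_mem_nhdsGT hlt] with w hw using hslope_le w hw
      have := le_of_tendsto hD hev
      linarith
    · -- `sStar` controlled: its (left) derivative is a limit of uncontrolled slopes
      push Not at hcase
      have hbad_below : ∀ w ∈ Ioo 0 sStar, β ≤ deriv R w := by
        intro w hw
        obtain ⟨u, hu, hwu⟩ := exists_lt_of_lt_csSup hBne hw.2
        exact (hdown u hu w ⟨hw.1, hw.2.trans hlt⟩ hwu.le).2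
      set d := deriv R sStar with hd
      have hslope_ge : ∀ w ∈ Ioo 0 sStar, β ≤ slope R w sStar := by
        intro w hw
        have key : ∀ u ∈ Ioo w sStar,
            (u - w) * β + (sStar - u) * d ≤ (sStar - w) * slope R w sStar := by
          intro u hu
          have hu' : u ∈ Ioo 0 s₀ := ⟨hw.1.trans hu.1, hu.2.trans hlt⟩
          have h1 : β ≤ slope R w u := (hbad_below u ⟨hu'.1, hu.2⟩).trans
            (hR.deriv_le_slope hw.1.le hu'.1.le hu.1 (hdiff u hu'))
          have h2 : d ≤ slope R u sStar := hR.deriv_le_slope hu'.1.le hpos.le hu.2 (hdiff sStar hmemS)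
          have h3 : sStar - w ≠ 0 := sub_ne_zero.2 hw.2.ne'
          have h4 : u - w ≠ 0 := sub_ne_zero.2 hu.1.ne'
          have h5 : sStar - u ≠ 0 := sub_ne_zero.2 hu.2.ne'
          have hid : (sStar - w) * slope R w sStar =
              (u - w) * slope R w u + (sStar - u) * slope R u sStar := by
            simp only [slope_def_field]
            rw [mul_div_cancel₀ _ h3, mul_div_cancel₀ _ h4, mul_div_cancel₀ _ h5]
            ring
          rw [hid]
          nlinarith [h1, h2, hu.1, hu.2]
        have htend : Tendsto (fun u => (u - w) * β + (sStar - u) * d) (𝓝[<] sStar)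
            (𝓝 ((sStar - w) * β + (sStar - sStar) * d)) :=
          (((continuous_id.sub continuous_const).mul continuous_const).add
            ((continuous_const.sub continuous_id).mul continuous_const)).continuousAt.tendsto.mono_left
            nhdsWithin_le_nhds
        have hev : ∀ᶠ u in 𝓝[<] sStar,
            (u - w) * β + (sStar - u) * d ≤ (sStar - w) * slope R w sStar := by
          filter_upwards [Ioo_mem_nhdsLT hw.2] with u hu using key u hu
        have hlim := le_of_tendsto htend hev
        rw [sub_self, zero_mul, add_zero] at hlim
        exact le_of_mul_le_mul_left hlim (sub_pos.2 hw.2)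
      have hD : Tendsto (fun w => slope R w sStar) (𝓝[<] sStar) (𝓝 d) := by
        have h := (hasDerivWithinAt_iff_tendsto_slope' self_notMem_Iio).1
          ((hdiff sStar hmemS).hasDerivAt.hasDerivWithinAt (s := Iio sStar))
        refine h.congr fun w => ?_
        rw [slope_comm]
      have hev : ∀ᶠ w in 𝓝[<] sStar, β ≤ slope R w sStar := by
        filter_upwards [Ioo_mem_nhdsLT hpos] with w hw using hslope_ge w hw
      have := ge_of_tendsto hD hev
      linarith
  -- Step 4: chord(s) is a limit of slopes from controlled points
  intro s hs
  have hderiv_bd : ∀ u ∈ Ioo 0 s₀, deriv R u ≤ slope R 0 s₀ + T := by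
    intro u hu
    have h := step2 u hu fun w hw => hallgood w ⟨hu.1.trans hw.1, hw.2⟩
    linarith [hT u hu]
  have htend : Tendsto (fun u => slope R u s) (𝓝[>] 0) (𝓝 (slope R 0 s)) := by
    simp only [slope_def_field]
    have hR0' : ContinuousWithinAt R (Ioi 0) 0 := hR0.mono Ioi_subset_Ici_self
    exact ((continuousWithinAt_const.sub hR0').div (continuousWithinAt_const.sub continuousWithinAt_id)
      (by simpa using hs.1.ne')).tendsto
  have hev : ∀ᶠ u in 𝓝[>] 0, slope R u s ≤ slope R 0 s₀ + T := by
    filter_upwards [Ioo_mem_nhdsGT hs.1] with u hu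
    have hu' : u ∈ Ioo 0 s₀ := ⟨hu.1, hu.2.trans_le hs.2⟩
    exact (hR.slope_le_deriv hu.1.le (hu.1.trans hu.2).le hu.2 (hdiff u hu')).trans (hderiv_bd u hu')
  exact le_of_tendsto htend hev


/-! ### The square-root budget of the route -/

/-- `d/du (4A√u) = 2·(A/√u)` for `u > 0`: the susceptibility majorant `K(u) = A/√u`
(`A = CN/(c√(ρa))`) has the budget function `g(u) = 4A√u`. [folklore] -/
theorem hasDerivAt_sqrt_budget (A : ℝ) {u : ℝ} (hu : 0 < u) :
    HasDerivAt (fun t => 4 * A * Real.sqrt t) (2 * (A / Real.sqrt u)) u :=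
  ((Real.hasDerivAt_sqrt hu.ne').const_mul (4 * A)).congr_deriv (by ring)

/-- `d/du ((8A/3) u√u) = 4A√u` for `u > 0`: the comparison function `G(u) = (8A/3)u^{3/2}` with
`G'' = 2K`. [folklore] -/
theorem hasDerivAt_sqrt_potential (A : ℝ) {u : ℝ} (hu : 0 < u) :
    HasDerivAt (fun t => 8 * A / 3 * (t * Real.sqrt t)) (4 * A * Real.sqrt u) u := by
  have h1 : HasDerivAt (fun t => t * Real.sqrt t) (1 * Real.sqrt u + u * (1 / (2 * Real.sqrt u))) u :=
    (hasDerivAt_id' u).mul (Real.hasDerivAt_sqrt hu.ne')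
  refine (h1.const_mul (8 * A / 3)).congr_deriv ?_
  have hsq : Real.sqrt u * Real.sqrt u = u := Real.mul_self_sqrt hu.le
  have hux : u * (1 / (2 * Real.sqrt u)) = Real.sqrt u / 2 := by
    rw [mul_one_div, div_eq_div_iff (by positivity) two_ne_zero]
    linear_combination (-2) * hsq
  rw [hux]
  ring

/-- **The abstract reward walk with the square-root susceptibility.** If the concave reward curve
`R` (right-continuous at `0`, differentiable on `(0, s₀)`) has, at every `u ∈ (0, s₀)` with
`R'(u) < β`, the pointwise response bound `R(u+h) + R(u-h) - 2R(u) ≥ -(2A/√u + ε)h²` (frequently as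
`h → 0⁺`, every `ε > 0`) — i.e. `-R'' ≤ 2Var/Δ ≤ 2CN/(c√(ρa u))` in variational form — and
`chord(s₀) ≤ β₀` with `β₀ + 4A√s₀ < β`, then `chord(s) ≤ chord(s₀) + T` for all `s ∈ (0, s₀]` as
soon as `4A√s₀ ≤ T` (`∫₀^{s₀} 2A/√u du = 4A√s₀`). With `A = CN/(c√(ρa))`, `s₀ = θρa` this is the
walk budget `(4C√θ/c)N` of the route. [folklore] -/
theorem chord_le_chord_add_of_sqrt_budget {R : ℝ → ℝ} {s₀ A β β₀ T : ℝ}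
    (hR : ConcaveOn ℝ (Ici 0) R) (hR0 : ContinuousWithinAt R (Ici 0) 0) (hs₀ : 0 < s₀)
    (hdiff : ∀ u ∈ Ioo 0 s₀, DifferentiableAt ℝ R u) (hA : 0 ≤ A)
    (hloc : ∀ u ∈ Ioo 0 s₀, deriv R u < β → ∀ ε : ℝ, 0 < ε →
      ∃ᶠ h in 𝓝[>] (0 : ℝ),
        -((2 * (A / Real.sqrt u) + ε) * h ^ 2) ≤ R (u + h) + R (u - h) - 2 * R u)
    (hinit : slope R 0 s₀ ≤ β₀) (hβ : β₀ + 4 * A * Real.sqrt s₀ < β)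
    (hT : 4 * A * Real.sqrt s₀ ≤ T) :
    ∀ s ∈ Ioc 0 s₀, slope R 0 s ≤ slope R 0 s₀ + T := by
  refine chord_le_chord_add_of_bootstrap (G := fun t => 8 * A / 3 * (t * Real.sqrt t))
    (g := fun t => 4 * A * Real.sqrt t) (K := fun u => A / Real.sqrt u) (β₁ := 4 * A * Real.sqrt s₀)
    hR hR0 hs₀ hdiff (fun u hu => hasDerivAt_sqrt_potential A hu.1)
    (fun u hu => hasDerivAt_sqrt_budget A hu.1) hloc hinit ?_ (by positivity) hβ ?_
  · intro u hu
    have : 0 ≤ 4 * A * Real.sqrt u := by positivity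
    linarith
  · intro u hu
    have : 0 ≤ 4 * A * Real.sqrt u := by positivity
    linarith

end Summit.AtomisticToContinuum.BoseEinsteinCondensation.Theorems.WalkGlue

end
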